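import Summits.BirchSwinnertonDyer.BirchSwinnertonDyer.Theorems.PrintCf2SplitBadTwoLocalControlKernelDyadicCM
import Summits.BirchSwinnertonDyer.BirchSwinnertonDyer.Theorems.PrintCf2SplitBadTwoCMPrimaryLocalTypesNamed
import HarnessLib

/-!
# Crux `PrintCf2.SplitBadTwoRankOneOfFacts` (stmt-BirchSwinnertonDyer-20368), road α v10.2 — brick B15 file 3: the EXACT DYADIC VALUE
# `#H⁰(K_𝔭, E[𝔮^∞]) = 2` for a kernel-type summand — a MOVER of `E[𝔮^∞][4]` in `D_𝔭` from a test element of prescribed parity on `√(−d)`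

Cell `bsd-print-cf2`, width seat `bsd-line-cf2-p1-w2` g9 (prover-bsd-line-cf2-p1-w2-g9-0); brick B15 (memo
`Cruxes/SplitBadTwoRankOneOfFacts/B15-DYADIC-EXACT-w2g9.md` §3, column `#W*(K_{v̄})`); `--supports stmt-BirchSwinnertonDyer-20368` (helper,
Theses-free). HONEST FRAMING: nothing here closes the crux or a registered stub; BSD is not proved by any of this; no summit statement is proved by
this seat. No definition, no named fact, no `sorry`. Sequel of p656168 (`#H⁰ ∈ {2, 4}`), p657782 (named local types), p661197 (cocyclic `E[𝔮^∞]`).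

WHAT. `W/ℚ` with `j = −3375`, `K ∋ θ`, `θ² = −7`, `π² = π − 2`, a place `𝔭` of `K`, `res : Γ_{K_𝔭} → Γ_K`, `ι = absClosureEmbedding ℚ K`, `A := ι√d`,
`Z := ι√(−1)` (a primitive fourth root of unity), `ε = χ₂` the `2`-adic cyclotomic character, `α ∈ ℤ₂ˣ` the unit root of `X² − X + 2`.
* §1 `cyclotomicCharacter_sub_one_mem_span_four_of_smul_eq` / `…_add_one_…_of_smul_eq_neg` — `g • Z = Z ⇒ ε(g) ≡ 1 (mod 4)`, `g • Z = −Z ⇒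
  ε(g) ≡ −1 (mod 4)` (`GaloisRep.cyclotomicCharacter_spec` on `Z`, `Z² = −1`); `toZModPow_two_unitRoot` — `α ≡ −1 (mod 4)` (`(α + 1)(α − 2) = −4`).
* §2 **`smul_eq_neg_of_kernelType`** — THE MOVER. Let `C'` carry the KERNEL-TYPE clause (R) of p657782 at `𝔭` (`res σ` of Frobenius degree `n` acts
  on `C'[2^k]` as any `N ≡ s·ε(res σ)·α^{−n}`, `s` the sign of `res σ` on `A`). If `σ` has degree `n`, sign `s` on `A`, sign `e` on `Z`, and
  `s·e = (−1)^{n+1}` — i.e. `res σ` acts on `√(−d) = ±A·Z` by `(−1)^{n+1}` — then `res σ` acts as `−1` on `C'[4]` (`s·ε·α^{−n} ≡ s·e·(−1)ⁿ = −1 (mod 4)`).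
  `exists_mem_decomp_smul_ne_of_kernelType` — hence some `δ ∈ D_𝔭` MOVES a point of `C'[4]` (a point of order `4` exists, p646843).
* §3 **`natCard_fixedPoints_decomp_eq_two_of_exists_smul_ne`** — at a place `w ∈ {v, v̄}` above `2` of a quadratic `K ∋ √−7`, either summand: if some
  `δ ∈ D_w` moves a point of `E[𝔮_ρ^∞][4]`, then `#H⁰(K_w, E[𝔮_ρ^∞]) = #E[𝔮_ρ^∞]^{D_w} = 2` EXACTLY (it is `2` or `4` by p656168, and a fixed subgroup
  with `4` elements would be `E[𝔮_ρ^∞][4]`, cocyclicity p661197).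
The TEST ELEMENTS for the S3c₂ frame (kernel type at `v̄` for the module pinned at `v`): `d` even — a dyadic Kummer inertia element negating
`√(−d)` (`n = 0`); `d ≡ 7 (8)` — a degree-`1` element (it fixes `√(−d) ∈ K_{v̄}`); they give `#W*(K_{v̄}) = 2` for `d ≢ 3 (8)` (file 4). For `d ≡ 3 (8)`
the value is `4` (memo §3; converse direction, needs the unramified quadratic character, not claimed). presearch: Rubin LNM 1716 §3 Lemma 3.6 (ii),
Cor. 3.17 (local characters of the CM summands above `p`), Agboola 2007 §6 / Prop. 8.1 (`#W*(K_𝔭)` in the leading term), Serre *Abelian ℓ-adic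
representations* I §1.2 (cyclotomic character) — held; no fact filed. beyond-print theorem: no.

References: [Rubin1999] §3 Lemma 3.6 (ii), Cor. 3.17; [Agboola2007] §6, Prop. 8.1; [SerreAbelianLadic1968] Ch. I §1.2; [NeukirchANT1999] II (9.6).
-/

noncomputable section

open scoped Classical

set_option linter.dupNamespace false
set_option autoImplicit false

namespace Summit.BirchSwinnertonDyer.BirchSwinnertonDyer.Theorems.PrintCf2.CMPrimes

open WeierstrassCurve Literature.NumberTheory.EllipticCurves Literature.NumberTheory.GaloisRepresentations Field NumberField
  IsDedekindDomain

/-! ## §1. `ε (mod 4)` read off the fourth root of unity `Z = ι√(−1)`; `α ≡ −1 (mod 4)` -/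

section Zeta

variable (K : Type) [Field K] [NumberField K]

/-- `Z := ι(√−1) ∈ K̄` squares to `−1`. [folklore] -/
theorem absClosureEmbedding_geomSqrt_neg_one_sq :
    absClosureEmbedding ℚ K (WeierstrassCurve.geomSqrt (-1 : ℚ)) ^ 2 = -1 := by
  rw [← map_pow, WeierstrassCurve.geomSqrt_sq, AlgHom.commutes, map_neg, map_one]

/-- Fourth powers of `Z = ι√(−1)` by the residue of the exponent: `Z^m` for `m < 4` is `1, Z, −1, −Z`; the four values are distinct from the
wrong targets (`K̄` has characteristic `0`). [folklore] -/
theorem geomSqrt_neg_one_pow_eq_self_iff {m : ℕ} (hm : m < 4) :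
    (absClosureEmbedding ℚ K (WeierstrassCurve.geomSqrt (-1 : ℚ)) ^ m =
        absClosureEmbedding ℚ K (WeierstrassCurve.geomSqrt (-1 : ℚ)) ↔ m = 1) ∧
    (absClosureEmbedding ℚ K (WeierstrassCurve.geomSqrt (-1 : ℚ)) ^ m =
        -absClosureEmbedding ℚ K (WeierstrassCurve.geomSqrt (-1 : ℚ)) ↔ m = 3) := by
  set Z := absClosureEmbedding ℚ K (WeierstrassCurve.geomSqrt (-1 : ℚ)) with hZ_def
  have hZ2 : Z ^ 2 = -1 := absClosureEmbedding_geomSqrt_neg_one_sq K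
  have hZ0 : Z ≠ 0 := fun h ↦ by rw [h, zero_pow two_ne_zero] at hZ2; exact one_ne_zero (neg_eq_zero.mp hZ2.symm)
  have h2 : (2 : AlgebraicClosure K) ≠ 0 := two_ne_zero
  have hZne1 : Z ≠ 1 := fun h ↦ by
    rw [h, one_pow] at hZ2
    exact h2 (by linear_combination hZ2)
  have hZnem1 : Z ≠ -1 := fun h ↦ by
    rw [h, neg_one_sq] at hZ2
    exact h2 (by linear_combination hZ2)
  have hZneg : Z ≠ -Z := fun h ↦ hZ0 (by linear_combination h / 2)
  have hZ3 : Z ^ 3 = -Z := by rw [pow_succ, hZ2, neg_one_mul]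
  interval_cases m
  · rw [pow_zero]
    exact ⟨⟨fun h ↦ absurd h.symm hZne1, fun h ↦ by omega⟩, ⟨fun h ↦ absurd (neg_eq_iff_eq_neg.mp h.symm) hZnem1, fun h ↦ by omega⟩⟩
  · rw [pow_one]
    exact ⟨⟨fun _ ↦ rfl, fun _ ↦ rfl⟩, ⟨fun h ↦ absurd h hZneg, fun h ↦ by omega⟩⟩
  · rw [hZ2]
    exact ⟨⟨fun h ↦ absurd h.symm hZnem1, fun h ↦ by omega⟩, ⟨fun h ↦ absurd (neg_inj.mp h).symm hZne1, fun h ↦ by omega⟩⟩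
  · rw [hZ3]
    exact ⟨⟨fun h ↦ absurd h.symm hZneg, fun h ↦ by omega⟩, ⟨fun _ ↦ rfl, fun _ ↦ rfl⟩⟩

/-- **`g • ζ₄ = ζ₄ ⇒ ε(g) ≡ 1 (mod 4)` and `g • ζ₄ = −ζ₄ ⇒ ε(g) ≡ −1 (mod 4)`** for `ζ₄ = ι√(−1)` and the `2`-adic cyclotomic character
(`GaloisRep.cyclotomicCharacter_spec`: `g • ζ = ζ^{ε(g) mod 4}`). [cite: SerreAbelianLadic1968, Ch. I §1.2] -/
theorem cyclotomicCharacter_mem_span_four_of_smul_geomSqrt_neg_one (g : absoluteGaloisGroup K) :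
    (g • absClosureEmbedding ℚ K (WeierstrassCurve.geomSqrt (-1 : ℚ)) = absClosureEmbedding ℚ K (WeierstrassCurve.geomSqrt (-1 : ℚ)) →
      (((GaloisRep.cyclotomicCharacter K 2 g : ℤ_[2]ˣ) : ℤ_[2]) - 1) ∈ (Ideal.span {(2 : ℤ_[2]) ^ 2} : Ideal ℤ_[2])) ∧
    (g • absClosureEmbedding ℚ K (WeierstrassCurve.geomSqrt (-1 : ℚ)) = -absClosureEmbedding ℚ K (WeierstrassCurve.geomSqrt (-1 : ℚ)) →
      (((GaloisRep.cyclotomicCharacter K 2 g : ℤ_[2]ˣ) : ℤ_[2]) + 1) ∈ (Ideal.span {(2 : ℤ_[2]) ^ 2} : Ideal ℤ_[2])) := by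
  haveI : Fact (Nat.Prime 2) := ⟨Nat.prime_two⟩
  haveI : Fact (1 < 2 ^ 2) := ⟨by norm_num⟩
  set Z := absClosureEmbedding ℚ K (WeierstrassCurve.geomSqrt (-1 : ℚ)) with hZ_def
  have hZ4 : Z ^ 2 ^ 2 = 1 := by
    rw [show (2 : ℕ) ^ 2 = 2 * 2 from rfl, pow_mul, absClosureEmbedding_geomSqrt_neg_one_sq K, neg_one_sq]
  have hspec := GaloisRep.cyclotomicCharacter_spec K 2 (k := 2) g Z hZ4
  set c := (GaloisRep.cyclotomicCharacter K 2 g).val.toZModPow 2 with hc_def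
  have hpow := geomSqrt_neg_one_pow_eq_self_iff K (ZMod.val_lt c)
  have h2 : (2 : ℤ_[2]) = ((2 : ℕ) : ℤ_[2]) := by norm_cast
  constructor
  · intro h
    rw [hspec] at h
    have hc1 : c = 1 := ZMod.val_injective _ (by rw [hpow.1.mp h, ZMod.val_one])
    rw [h2, ← PadicInt.ker_toZModPow, RingHom.mem_ker, map_sub, map_one, sub_eq_zero]
    exact hc1
  · intro h
    rw [hspec] at h
    have hc3 : c = 3 := ZMod.val_injective _ (by rw [hpow.2.mp h]; rfl)
    rw [h2, ← PadicInt.ker_toZModPow, RingHom.mem_ker, map_add, map_one]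
    change c + 1 = 0
    rw [hc3]; rfl

/-- Arithmetic in `ℤ/4`: a unit `t` with `t² = t − 2` is `−1`, and so is its inverse. [folklore] -/
private theorem zmod_four_unitRoot_aux : ∀ t t' : ZMod (2 ^ 2), t * t' = 1 → t ^ 2 = t - 2 → t = -1 ∧ t' = -1 := by decide

/-- **`α ≡ −1 (mod 4)`** for a unit root `α` of `X² − X + 2` in `ℤ₂`: in `ℤ/4` the image `t` of `α` is a unit with `t² = t − 2`, so `t = 3`;
hence also `α⁻¹ ≡ −1 (mod 4)`. [folklore] -/
theorem toZModPow_two_unitRoot {α : ℤ_[2]ˣ} (hα : (α : ℤ_[2]) ^ 2 = (α : ℤ_[2]) - 2) :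
    PadicInt.toZModPow 2 ((α : ℤ_[2]ˣ) : ℤ_[2]) = -1 ∧ PadicInt.toZModPow 2 ((α⁻¹ : ℤ_[2]ˣ) : ℤ_[2]) = -1 := by
  haveI : Fact (Nat.Prime 2) := ⟨Nat.prime_two⟩
  have htt : PadicInt.toZModPow 2 ((α : ℤ_[2]ˣ) : ℤ_[2]) * PadicInt.toZModPow 2 ((α⁻¹ : ℤ_[2]ˣ) : ℤ_[2]) = 1 := by
    rw [← map_mul, Units.mul_inv, map_one]
  have heq : PadicInt.toZModPow 2 ((α : ℤ_[2]ˣ) : ℤ_[2]) ^ 2 = PadicInt.toZModPow 2 ((α : ℤ_[2]ˣ) : ℤ_[2]) - 2 := by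
    have := congrArg (PadicInt.toZModPow 2) hα
    rwa [map_pow, map_sub, map_ofNat] at this
  exact zmod_four_unitRoot_aux _ _ htt heq

end Zeta

/-! ## §2. The mover of `C'[4]` for a kernel-type summand -/

section Mover

variable (K : Type) [Field K] [NumberField K] (W : WeierstrassCurve ℚ)

/-- **THE MOVER.** `C' ≤ E_K[2^∞]` a subgroup carrying the KERNEL-TYPE clause (R) of p657782 at the place `𝔭` for the unit `α` (`α² = α − 2`) and the
twist parameter `d`: every `σ ∈ Γ_{K_𝔭}` of Frobenius degree `n`, with sign `s` on `A = ι√d`, acts on `C'[2^k]` as any `N ≡ s·ε(res σ)·α^{−n} (mod 2^k)`.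
If `σ` has sign `e` on `Z = ι√(−1)` and `s·e = (−1)^{n+1}` (so `res σ` acts on `±√(−d) = A·Z` by `(−1)^{n+1}`), then `res σ` acts as `−1` on
`C'[4]`: `s·ε·α^{−n} ≡ s·e·(−1)^n = −1 (mod 4)` (§1). [cite: Rubin1999, §3 Lemma 3.6 (ii) and Cor. 3.17] -/
theorem smul_eq_neg_of_kernelType {𝔭 : HeightOneSpectrum (𝓞 K)} {C' : AddSubgroup ((W.baseChange K).geomPrimaryTorsion 2)}
    {α : ℤ_[2]ˣ} (hα : (α : ℤ_[2]) ^ 2 = (α : ℤ_[2]) - 2) {d : ℚ}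
    (HR : ∀ (σ : absoluteGaloisGroup (𝔭.adicCompletion K)) (n : ℕ), IsFrobPow σ (n : ℤ) →
        ∀ s : ℤ,
          ((absGaloisRestrict K (𝔭.adicCompletion K) σ • absClosureEmbedding ℚ K (WeierstrassCurve.geomSqrt d) =
              absClosureEmbedding ℚ K (WeierstrassCurve.geomSqrt d) ∧ s = 1) ∨
           (absGaloisRestrict K (𝔭.adicCompletion K) σ • absClosureEmbedding ℚ K (WeierstrassCurve.geomSqrt d) =
              -absClosureEmbedding ℚ K (WeierstrassCurve.geomSqrt d) ∧ s = -1)) →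
          ∀ (k : ℕ), ∀ x ∈ C', 2 ^ k • x = 0 →
            ∀ N : ℤ, ((N : ℤ_[2]) - s *
                ((GaloisRep.cyclotomicCharacter K 2 (absGaloisRestrict K (𝔭.adicCompletion K) σ) * (α⁻¹) ^ n :
                  ℤ_[2]ˣ) : ℤ_[2])) ∈ (Ideal.span {(2 : ℤ_[2]) ^ k} : Ideal ℤ_[2]) →
              absGaloisRestrict K (𝔭.adicCompletion K) σ • x = N • x)
    {σ : absoluteGaloisGroup (𝔭.adicCompletion K)} {n : ℕ} (hσ : IsFrobPow σ (n : ℤ)) {s e : ℤ}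
    (hs : (absGaloisRestrict K (𝔭.adicCompletion K) σ • absClosureEmbedding ℚ K (WeierstrassCurve.geomSqrt d) =
              absClosureEmbedding ℚ K (WeierstrassCurve.geomSqrt d) ∧ s = 1) ∨
           (absGaloisRestrict K (𝔭.adicCompletion K) σ • absClosureEmbedding ℚ K (WeierstrassCurve.geomSqrt d) =
              -absClosureEmbedding ℚ K (WeierstrassCurve.geomSqrt d) ∧ s = -1))
    (he : (absGaloisRestrict K (𝔭.adicCompletion K) σ • absClosureEmbedding ℚ K (WeierstrassCurve.geomSqrt (-1 : ℚ)) =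
              absClosureEmbedding ℚ K (WeierstrassCurve.geomSqrt (-1 : ℚ)) ∧ e = 1) ∨
           (absGaloisRestrict K (𝔭.adicCompletion K) σ • absClosureEmbedding ℚ K (WeierstrassCurve.geomSqrt (-1 : ℚ)) =
              -absClosureEmbedding ℚ K (WeierstrassCurve.geomSqrt (-1 : ℚ)) ∧ e = -1))
    (hse : s * e = (-1) ^ (n + 1)) {x : (W.baseChange K).geomPrimaryTorsion 2} (hx : x ∈ C') (hx4 : 4 • x = 0) :
    absGaloisRestrict K (𝔭.adicCompletion K) σ • x = -x := by
  haveI : Fact (Nat.Prime 2) := ⟨Nat.prime_two⟩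
  set g := absGaloisRestrict K (𝔭.adicCompletion K) σ with hg_def
  set ε := GaloisRep.cyclotomicCharacter K 2 g with hε_def
  -- `ε ≡ e (mod 4)`
  have hεe : PadicInt.toZModPow 2 ((ε : ℤ_[2]ˣ) : ℤ_[2]) = (e : ZMod (2 ^ 2)) := by
    have h2 : (2 : ℤ_[2]) = ((2 : ℕ) : ℤ_[2]) := by norm_cast
    obtain ⟨hZ, rfl⟩ | ⟨hZ, rfl⟩ := he
    · have h := (cyclotomicCharacter_mem_span_four_of_smul_geomSqrt_neg_one K g).1 hZ
      rw [h2, ← PadicInt.ker_toZModPow, RingHom.mem_ker, map_sub, map_one, sub_eq_zero] at h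
      rw [h, Int.cast_one]
    · have h := (cyclotomicCharacter_mem_span_four_of_smul_geomSqrt_neg_one K g).2 hZ
      rw [h2, ← PadicInt.ker_toZModPow, RingHom.mem_ker, map_add, map_one] at h
      rw [Int.cast_neg, Int.cast_one, eq_neg_iff_add_eq_zero, h]
  have hαinv := (toZModPow_two_unitRoot hα).2
  -- the congruence `−1 ≡ s·ε·α^{−n} (mod 4)`
  have hmem : (((-1 : ℤ) : ℤ_[2]) - s * ((ε * (α⁻¹) ^ n : ℤ_[2]ˣ) : ℤ_[2])) ∈ (Ideal.span {(2 : ℤ_[2]) ^ 2} : Ideal ℤ_[2]) := by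
    rw [show (2 : ℤ_[2]) = ((2 : ℕ) : ℤ_[2]) by norm_cast, ← PadicInt.ker_toZModPow, RingHom.mem_ker]
    rw [map_sub, map_mul, map_intCast, map_intCast, Units.val_mul, Units.val_pow_eq_pow_val, map_mul, map_pow, hεe, hαinv]
    have hse' : ((s : ZMod (2 ^ 2)) * e) = (-1) ^ (n + 1) := by exact_mod_cast congrArg (Int.cast : ℤ → ZMod (2 ^ 2)) hse
    rw [show ((s : ZMod (2 ^ 2)) * ((e : ZMod (2 ^ 2)) * (-1) ^ n)) = ((s : ZMod (2 ^ 2)) * e) * (-1) ^ n by ring, hse',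
      ← pow_add, Odd.neg_one_pow ⟨n, by ring⟩, Int.cast_neg, Int.cast_one, sub_self]
  have h := HR σ n hσ s hs 2 x hx (by simpa using hx4) (-1) hmem
  rwa [neg_one_zsmul] at h

variable [W.IsElliptic]

/-- **Some `δ ∈ D_𝔭` MOVES a point of `C'[4]`** — with `C' = E[𝔮_{ρ'}^∞]` a CM summand carrying the kernel-type clause (R) at `𝔭` (`j = −3375`,
`θ² = −7` in `K`, `π² = π − 2`, `ρ'` either root), given a test element `σ ∈ Γ_{K_𝔭}` as in `smul_eq_neg_of_kernelType` (degree `n`, signs `s`, `e`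
with `s·e = (−1)^{n+1}`): `res σ` negates a point of order `4` (which exists, p646843). [cite: Rubin1999, §3 Lemma 3.6 (ii) and Cor. 3.17] -/
theorem exists_mem_decomp_smul_ne_of_kernelType (hj : W.j = -3375) {θ : K} (hθ : θ ^ 2 = -7)
    (π : (W.baseChange K).endRing) (hrel : (π : AddMonoid.End (W.baseChange K).geomPoints) * π = π - 2)
    {ρ' : ℤ_[2]} (hρ' : ρ' * ρ' = ρ' - 2) {𝔭 : HeightOneSpectrum (𝓞 K)}
    {α : ℤ_[2]ˣ} (hα : (α : ℤ_[2]) ^ 2 = (α : ℤ_[2]) - 2) {d : ℚ}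
    (HR : ∀ (σ : absoluteGaloisGroup (𝔭.adicCompletion K)) (n : ℕ), IsFrobPow σ (n : ℤ) →
        ∀ s : ℤ,
          ((absGaloisRestrict K (𝔭.adicCompletion K) σ • absClosureEmbedding ℚ K (WeierstrassCurve.geomSqrt d) =
              absClosureEmbedding ℚ K (WeierstrassCurve.geomSqrt d) ∧ s = 1) ∨
           (absGaloisRestrict K (𝔭.adicCompletion K) σ • absClosureEmbedding ℚ K (WeierstrassCurve.geomSqrt d) =
              -absClosureEmbedding ℚ K (WeierstrassCurve.geomSqrt d) ∧ s = -1)) →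
          ∀ (k : ℕ), ∀ x ∈ (W.baseChange K).endEigenPrimaryTorsion 2 π ρ', 2 ^ k • x = 0 →
            ∀ N : ℤ, ((N : ℤ_[2]) - s *
                ((GaloisRep.cyclotomicCharacter K 2 (absGaloisRestrict K (𝔭.adicCompletion K) σ) * (α⁻¹) ^ n :
                  ℤ_[2]ˣ) : ℤ_[2])) ∈ (Ideal.span {(2 : ℤ_[2]) ^ k} : Ideal ℤ_[2]) →
              absGaloisRestrict K (𝔭.adicCompletion K) σ • x = N • x)
    {σ : absoluteGaloisGroup (𝔭.adicCompletion K)} {n : ℕ} (hσ : IsFrobPow σ (n : ℤ)) {s e : ℤ}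
    (hs : (absGaloisRestrict K (𝔭.adicCompletion K) σ • absClosureEmbedding ℚ K (WeierstrassCurve.geomSqrt d) =
              absClosureEmbedding ℚ K (WeierstrassCurve.geomSqrt d) ∧ s = 1) ∨
           (absGaloisRestrict K (𝔭.adicCompletion K) σ • absClosureEmbedding ℚ K (WeierstrassCurve.geomSqrt d) =
              -absClosureEmbedding ℚ K (WeierstrassCurve.geomSqrt d) ∧ s = -1))
    (he : (absGaloisRestrict K (𝔭.adicCompletion K) σ • absClosureEmbedding ℚ K (WeierstrassCurve.geomSqrt (-1 : ℚ)) =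
              absClosureEmbedding ℚ K (WeierstrassCurve.geomSqrt (-1 : ℚ)) ∧ e = 1) ∨
           (absGaloisRestrict K (𝔭.adicCompletion K) σ • absClosureEmbedding ℚ K (WeierstrassCurve.geomSqrt (-1 : ℚ)) =
              -absClosureEmbedding ℚ K (WeierstrassCurve.geomSqrt (-1 : ℚ)) ∧ e = -1))
    (hse : s * e = (-1) ^ (n + 1)) :
    ∃ δ ∈ GreenbergSelmer.decomp 𝔭, ∃ x ∈ (W.baseChange K).endEigenPrimaryTorsion 2 π ρ', 4 • x = 0 ∧ δ • x ≠ x := by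
  obtain ⟨-, -, -, -, -, -, hgen, -⟩ := endEigenPrimaryTorsion_two_structure W hj K hθ π hrel hρ'
  obtain ⟨g, hg, hord, -⟩ := hgen 2
  have hg4 : 4 • g = 0 := by rw [show (4 : ℕ) = 2 ^ 2 from rfl, ← hord]; exact addOrderOf_nsmul_eq_zero g
  have hg2 : 2 • g ≠ 0 := fun h ↦ by
    have hdvd : addOrderOf g ∣ 2 := addOrderOf_dvd_of_nsmul_eq_zero h
    rw [hord] at hdvd
    exact absurd (Nat.le_of_dvd two_pos hdvd) (by norm_num)
  refine ⟨absGaloisRestrict K (𝔭.adicCompletion K) σ, ⟨σ, rfl⟩, g, hg, hg4, fun h ↦ hg2 ?_⟩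
  rw [smul_eq_neg_of_kernelType K W hα HR hσ hs he hse hg hg4] at h
  rw [two_nsmul]
  exact neg_eq_iff_add_eq_zero.mp h

end Mover

/-! ## §3. A mover pins the dyadic value: `#H⁰(K_w, E[𝔮_ρ^∞]) = 2` -/

section Card

variable (W : WeierstrassCurve ℚ) [W.IsElliptic] (K : Type) [Field K] [NumberField K]

/-- **A MOVER OF `E[𝔮_ρ^∞][4]` IN `D_w` PINS `#H⁰(K_w, E[𝔮_ρ^∞]) = 2`.** `j = −3375`, `[K:ℚ] = 2` with `θ² = −7`, `w' ≠ w` the places above `2`,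
`π² = π − 2`, `ρ` either root: if some `δ ∈ GreenbergSelmer.decomp w` moves some `x ∈ E[𝔮_ρ^∞]` with `4x = 0`, then the `D_w`-fixed subgroup of the
module `↥E[𝔮_ρ^∞]` has exactly `2` elements (it has `2` or `4` by p656168; a fixed subgroup with `4` elements is contained in, hence equal to,
`E[𝔮_ρ^∞][4]` — every fixed `y` generates the level of its order, p661197 — and would contain `x`). [cite: Rubin1999, §2 and Prop. 5.4]
[cite: Agboola2007, §6 and Prop. 8.1] -/
theorem natCard_fixedPoints_decomp_eq_two_of_exists_smul_ne (hj : W.j = -3375) (hK2 : Module.finrank ℚ K = 2) {θ : K}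
    (hθ : θ ^ 2 = -7) (π : (W.baseChange K).endRing) (hrel : (π : AddMonoid.End (W.baseChange K).geomPoints) * π = π - 2)
    {ρ : ℤ_[2]} (hρ : ρ * ρ = ρ - 2) {w w' : HeightOneSpectrum (𝓞 K)} (hw : ((2 : ℕ) : 𝓞 K) ∈ w.asIdeal)
    (hw' : ((2 : ℕ) : 𝓞 K) ∈ w'.asIdeal) (hne : w' ≠ w)
    (hmove : ∃ δ ∈ GreenbergSelmer.decomp w, ∃ x ∈ (W.baseChange K).endEigenPrimaryTorsion 2 π ρ, 4 • x = 0 ∧ δ • x ≠ x) :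
    Nat.card (FixedPoints.addSubgroup (GreenbergSelmer.decomp w) ↥((W.baseChange K).endEigenPrimaryTorsion 2 π ρ)) = 2 := by
  haveI : Fact (Nat.Prime 2) := ⟨Nat.prime_two⟩
  set C := (W.baseChange K).endEigenPrimaryTorsion 2 π ρ with hC_def
  obtain ⟨-, -, -, -, -, hcard, -, -⟩ := endEigenPrimaryTorsion_two_structure W hj K hθ π hrel hρ
  -- the fixed subgroup, in the ambient group
  let F : AddSubgroup ((W.baseChange K).geomPrimaryTorsion 2) := (FixedPoints.addSubgroup (GreenbergSelmer.decomp w) ↥C).map C.subtype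
  have hFle : F ≤ C := by rintro _ ⟨x, -, rfl⟩; exact x.2
  have hF2 : ∀ x ∈ C, 2 • x = 0 → x ∈ F := by
    intro x hx h2
    refine ⟨⟨x, hx⟩, ?_, rfl⟩
    rw [SetLike.mem_coe, FixedPoints.mem_addSubgroup]
    rintro ⟨δ, hδ⟩
    exact Subtype.ext (smul_eq_self_of_two_nsmul_eq_zero W K hj hθ π hrel hρ δ x hx h2)
  have hFfix : ∀ δ ∈ GreenbergSelmer.decomp w, ∀ x ∈ F, δ • x = x := by
    rintro δ hδ _ ⟨x, hx, rfl⟩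
    rw [SetLike.mem_coe, FixedPoints.mem_addSubgroup] at hx
    exact congrArg Subtype.val (hx ⟨δ, hδ⟩)
  have hcardF : Nat.card F = Nat.card (FixedPoints.addSubgroup (GreenbergSelmer.decomp w) ↥C) :=
    (Nat.card_congr (AddSubgroup.equivMapOfInjective _ C.subtype Subtype.val_injective).toEquiv).symm
  rw [← hcardF]
  rcases natCard_eq_two_or_four_of_fixed W K hj hK2 hθ π hrel hρ hw hw' hne F hFle hF2 hFfix with h | h4
  · exact h
  · exfalso
    obtain ⟨δ, hδ, x, hx, hx4, hδx⟩ := hmove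
    haveI : Finite ↥F := Nat.finite_of_card_ne_zero (by rw [h4]; norm_num)
    -- `F ≤ C[4]`: every `y ∈ F` has order `≤ 4` since `ℤ·y = C[2^j] ≤ F` has at most `4` elements
    have hF4 : F ≤ C ⊓ AddSubgroup.torsionBy ((W.baseChange K).geomPrimaryTorsion 2) (2 ^ 2 : ℕ) := by
      intro y hy
      obtain ⟨j, hj'⟩ := exists_addOrderOf_eq_two_pow W K y
      have hzle : AddSubgroup.zmultiples y ≤ F := AddSubgroup.zmultiples_le.mpr hy
      have hjle : 2 ^ j ≤ 4 := by
        rw [← hj', ← Nat.card_zmultiples y, ← h4]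
        exact Nat.card_le_card_of_injective _ (AddSubgroup.inclusion_injective hzle)
      refine ⟨hFle hy, AddSubgroup.torsionBy.nsmul_iff.mpr ?_⟩
      have hj2 : j ≤ 2 := by
        by_contra hlt
        have : 2 ^ 3 ≤ 2 ^ j := Nat.pow_le_pow_right two_pos (by omega)
        omega
      have hsplit : (2 : ℕ) ^ 2 = 2 ^ (2 - j) * 2 ^ j := by rw [← pow_add]; congr 1; omega
      rw [hsplit, mul_smul, ← hj', addOrderOf_nsmul_eq_zero, smul_zero]
    haveI : Finite ↥(C ⊓ AddSubgroup.torsionBy ((W.baseChange K).geomPrimaryTorsion 2) (2 ^ 2 : ℕ)) :=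
      Nat.finite_of_card_ne_zero (by rw [hcard 2]; norm_num)
    have hFeq : F = C ⊓ AddSubgroup.torsionBy ((W.baseChange K).geomPrimaryTorsion 2) (2 ^ 2 : ℕ) :=
      AddSubgroup.eq_of_le_of_card_ge hF4 (by rw [hcard 2, h4]; norm_num)
    have hxF : x ∈ F := by
      rw [hFeq]
      exact ⟨hx, AddSubgroup.torsionBy.nsmul_iff.mpr (by simpa using hx4)⟩
    exact hδx (hFfix δ hδ x hxF)

end Card

end Summit.BirchSwinnertonDyer.BirchSwinnertonDyer.Theorems.PrintCf2.CMPrimes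

end
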